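import Mathlib
import Literature.Probability.Percolation.QuadLowestCrossingProofs
import Literature.Probability.Percolation.IsoradialProofs
import Literature.Probability.LatticeModels.SquareTilingUniformization
import HarnessLib

/-!
# Boxes without short-way open crossings carry long-way paths off the drawn lattice

Helper file (Part `Duality`) for the stub `stub_pathPoint_upper` (N-hi) of the line `Sketch`
(crux `stmt-CriticalPhenomena-10269`, `…Theses.CardySelfRefinement.GradientComparability`): the
deterministic (topological) half of the UPPER bound on the joint crossing probability along an RSW
path.  The probabilistic half and the stub are `…StubPathPointUpper.lean`.

## Mathematics

Bond configurations of `ℤ²` are drawn at mesh `δ = η√2` (`meshPoint δ`, i.e. `η ·` the isoradial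
drawing `squareLatticeEmbedding.z = √2 · ℤ²`), open edges as segments (`openEdgeUnion`).

* **Lattice shadow** (`openCrossing_of_continuum_im` / `_re`; coordinates along a segment lie
  between those of its ends, `SquareTiling.im_mem_uIcc_of_mem_segment`).  A compact connected
  plane set inside the open edges and inside a rectangle, touching its bottom and top (resp. left
  and right) sides, yields an open lattice path through sites drawn in the `δ`-enlarged rectangle, from the
  lower end of the open edge through the low point to the upper end of the open edge through the
  high point (`openConnIn_of_isPreconnected_subset_openEdgeUnion`, Schramm–Smirnov's "no difference
  between connected and path-connected crossings").
* **The two boxes of a tube point `p`** (size `s`, integer scale `n` with `8s - η < ηn ≤ 8s`,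
  `6η ≤ s`).  Horizontal box: the plane rectangle
  `[p.re - 4s + √2η, p.re - 4s + ηn - √2η] × [p.im - s, p.im - s + ηn/8]`; an open continuum
  crossing it from bottom to top has as shadow an open top–bottom crossing of the explicit
  `n × n/8` lattice rectangle `embTBCrossing (√2· - u) n (n/8)`, `ηu = (p.re - 4s, p.im - s)`
  (`not_chartCrossed_H`, through the transposition chart `SSContinuity.swapC`); vertical box:
  the transposed statement with `embRectCrossing (√2· - u) (n/8) n`, `ηu = (p.re - s, p.im - 4s)`
  (`not_chartCrossed_V`, identity chart).
* **Continuum duality** (`SSContinuity.exists_dualPath_of_not_chartCrossed`, Schramm–Smirnov,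
  proof of Lemma 6.1): a rectangle without open continuum crossing between two opposite sides has
  a path between the other two sides off the drawn lattice (open edges AND vertices).  For the two
  boxes these are long-way paths in the band `[p.im - s, p.im + s]` reaching `re ≤ p.re - 3s`,
  `re ≥ p.re + 3s` (`dualH_continuum`) and in the strip `[p.re - s, p.re + s]` reaching
  `im ≤ p.im - 3s`, `im ≥ p.im + 3s` (`dualV_continuum`) — exactly the inputs of the `chain`
  lemma of the (D1) tube file, with `GOOD` the complement of the drawn lattice
  (`continua_of_not_mem`).
-/

noncomputable section

namespace Summit.CriticalPhenomena.CardyFormulaZ2.Theorems.CardySelfRefinement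

open Set Metric Complex
open Literature.Probability.LatticeModels Literature.Probability.Percolation

/-! ## The lattice shadow of an open continuum crossing of a plane rectangle -/

/-- The ends of the open edges drawn through a set inside a rectangle are drawn in the
`δ`-enlarged rectangle. -/
theorem fst_mem_of_mem_edgePairs {δ : ℝ} (hδ : 0 < δ) {ω : BondConfig (Site 2)} {K : Set ℂ}
    {x₁ x₂ y₁ y₂ : ℝ} (hKR : K ⊆ Icc x₁ x₂ ×ℂ Icc y₁ y₂) :
    ∀ e ∈ edgePairs δ ω K, e.1 ∈ {v : Site 2 |
      meshPoint δ v ∈ Icc (x₁ - δ) (x₂ + δ) ×ℂ Icc (y₁ - δ) (y₂ + δ)} := by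
  rintro e ⟨hadj, -, z, hzseg, hzK⟩
  have hd := dist_meshPoint_le_of_mem_segment hδ hadj hzseg
  rw [dist_eq_norm] at hd
  have hre := (Complex.abs_re_le_norm (meshPoint δ e.1 - z)).trans hd
  have him := (Complex.abs_im_le_norm (meshPoint δ e.1 - z)).trans hd
  rw [Complex.sub_re, abs_le] at hre
  rw [Complex.sub_im, abs_le] at him
  obtain ⟨⟨hz1, hz2⟩, hz3, hz4⟩ := Complex.mem_reProdIm.1 (hKR hzK)
  exact Complex.mem_reProdIm.2 ⟨⟨by linarith, by linarith⟩, by linarith, by linarith⟩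

/-- **Lattice shadow of a vertical open continuum crossing.**  A compact connected set inside the
drawn open edges (mesh `δ`) and inside the rectangle `[x₁,x₂] × [y₁,y₂]`, reaching `im ≤ y₁` and
`im ≥ y₂`, yields an open lattice path through sites drawn in the `δ`-enlarged rectangle from a
site drawn in `{im ≤ y₁}` to a site drawn in `{y₂ ≤ im}` (the lower end of the open edge through
the low point, the upper end of the one through the high point, chained by
`openConnIn_of_isPreconnected_subset_openEdgeUnion`). -/
theorem openCrossing_of_continuum_im {δ : ℝ} (hδ : 0 < δ) {ω : BondConfig (Site 2)} {K : Set ℂ}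
    (hKc : IsCompact K) (hKp : IsPreconnected K) (hKO : K ⊆ openEdgeUnion δ ω)
    {x₁ x₂ y₁ y₂ : ℝ} (hKR : K ⊆ Icc x₁ x₂ ×ℂ Icc y₁ y₂)
    (h₁ : ∃ p ∈ K, p.im ≤ y₁) (h₂ : ∃ q ∈ K, y₂ ≤ q.im) :
    ω ∈ openCrossing
      {v : Site 2 | meshPoint δ v ∈ Icc (x₁ - δ) (x₂ + δ) ×ℂ Icc (y₁ - δ) (y₂ + δ)}
      {v | (meshPoint δ v).im ≤ y₁} {v | y₂ ≤ (meshPoint δ v).im} := by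
  obtain ⟨p, hpK, hpy⟩ := h₁
  obtain ⟨e, he, hpe⟩ := exists_mem_edgePairs_of_mem hKO hpK
  obtain ⟨q, hqK, hqy⟩ := h₂
  obtain ⟨f, hf, hqf⟩ := exists_mem_edgePairs_of_mem hKO hqK
  have hlow : ∃ e' ∈ edgePairs δ ω K, (meshPoint δ e'.1).im ≤ y₁ := by
    have hmin := (SquareTiling.im_mem_uIcc_of_mem_segment hpe).1
    rcases le_total (meshPoint δ e.1).im (meshPoint δ e.2).im with h | h
    · exact ⟨e, he, by rw [min_eq_left h] at hmin; exact hmin.trans hpy⟩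
    · exact ⟨e.swap, swap_mem_edgePairs he, by rw [min_eq_right h] at hmin; exact hmin.trans hpy⟩
  have hhigh : ∃ e' ∈ edgePairs δ ω K, y₂ ≤ (meshPoint δ e'.1).im := by
    have hmax := (SquareTiling.im_mem_uIcc_of_mem_segment hqf).2
    rcases le_total (meshPoint δ f.1).im (meshPoint δ f.2).im with h | h
    · exact ⟨f.swap, swap_mem_edgePairs hf, by rw [max_eq_right h] at hmax; exact hqy.trans hmax⟩
    · exact ⟨f, hf, by rw [max_eq_left h] at hmax; exact hqy.trans hmax⟩
  obtain ⟨e₁, he₁, he₁y⟩ := hlow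
  obtain ⟨e₂, he₂, he₂y⟩ := hhigh
  exact ⟨e₁.1, he₁y, e₂.1, he₂y, openConnIn_of_isPreconnected_subset_openEdgeUnion hδ hKc hKp hKO
    (fst_mem_of_mem_edgePairs hδ hKR) he₁ he₂⟩

/-- **Lattice shadow of a horizontal open continuum crossing** (`openCrossing_of_continuum_im`
with the roles of `re` and `im` exchanged). -/
theorem openCrossing_of_continuum_re {δ : ℝ} (hδ : 0 < δ) {ω : BondConfig (Site 2)} {K : Set ℂ}
    (hKc : IsCompact K) (hKp : IsPreconnected K) (hKO : K ⊆ openEdgeUnion δ ω)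
    {x₁ x₂ y₁ y₂ : ℝ} (hKR : K ⊆ Icc x₁ x₂ ×ℂ Icc y₁ y₂)
    (h₁ : ∃ p ∈ K, p.re ≤ x₁) (h₂ : ∃ q ∈ K, x₂ ≤ q.re) :
    ω ∈ openCrossing
      {v : Site 2 | meshPoint δ v ∈ Icc (x₁ - δ) (x₂ + δ) ×ℂ Icc (y₁ - δ) (y₂ + δ)}
      {v | (meshPoint δ v).re ≤ x₁} {v | x₂ ≤ (meshPoint δ v).re} := by
  obtain ⟨p, hpK, hpx⟩ := h₁
  obtain ⟨e, he, hpe⟩ := exists_mem_edgePairs_of_mem hKO hpK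
  obtain ⟨q, hqK, hqx⟩ := h₂
  obtain ⟨f, hf, hqf⟩ := exists_mem_edgePairs_of_mem hKO hqK
  have hlow : ∃ e' ∈ edgePairs δ ω K, (meshPoint δ e'.1).re ≤ x₁ := by
    have hmin := (SquareTiling.re_mem_uIcc_of_mem_segment hpe).1
    rcases le_total (meshPoint δ e.1).re (meshPoint δ e.2).re with h | h
    · exact ⟨e, he, by rw [min_eq_left h] at hmin; exact hmin.trans hpx⟩
    · exact ⟨e.swap, swap_mem_edgePairs he, by rw [min_eq_right h] at hmin; exact hmin.trans hpx⟩
  have hhigh : ∃ e' ∈ edgePairs δ ω K, x₂ ≤ (meshPoint δ e'.1).re := by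
    have hmax := (SquareTiling.re_mem_uIcc_of_mem_segment hqf).2
    rcases le_total (meshPoint δ f.1).re (meshPoint δ f.2).re with h | h
    · exact ⟨f.swap, swap_mem_edgePairs hf, by rw [max_eq_right h] at hmax; exact hqx.trans hmax⟩
    · exact ⟨f, hf, by rw [max_eq_left h] at hmax; exact hqx.trans hmax⟩
  obtain ⟨e₁, he₁, he₁x⟩ := hlow
  obtain ⟨e₂, he₂, he₂x⟩ := hhigh
  exact ⟨e₁.1, he₁x, e₂.1, he₂x, openConnIn_of_isPreconnected_subset_openEdgeUnion hδ hKc hKp hKO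
    (fst_mem_of_mem_edgePairs hδ hKR) he₁ he₂⟩

/-! ## The two boxes around a tube point: no short-way open crossing ⇒ not chart-crossed -/

/-- **Horizontal box.**  If the explicit `n × n/8` rectangle (drawing `v ↦ √2 v - u`, left side
at `re = p.re - 4s`, bottom at `im = p.im - s` in mesh-`η` plane coordinates) has no open
top–bottom lattice crossing (`embTBCrossing`), then the plane rectangle
`[p.re - 4s + √2η, p.re - 4s + ηn - √2η] × [p.im - s, p.im - s + ηn/8]`, read through the
transposition chart `SSContinuity.swapC`, is not chart-crossed at mesh `η√2`. -/
theorem not_chartCrossed_H {η s : ℝ} (hη : 0 < η) {n : ℕ} (p : ℂ) {u : ℂ}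
    (hu₁ : η * u.re = p.re - 4 * s) (hu₂ : η * u.im = p.im - s) {ω : BondConfig (Site 2)}
    (hno : ω ∉ embTBCrossing (fun v => squareLatticeEmbedding.z v - u) n ((1 / 8 : ℝ) * n)) :
    ¬ SSContinuity.ChartCrossed SSContinuity.swapC (p.im - s) (p.im - s + η * n / 8)
      (p.re - 4 * s + Real.sqrt 2 * η) (p.re - 4 * s + η * n - Real.sqrt 2 * η)
      (η * Real.sqrt 2) ω := by
  rintro ⟨K, hKsub, hKc, hKconn, hKO, ⟨u₁, hu₁K, hu₁re⟩, ⟨u₂, hu₂K, hu₂re⟩⟩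
  obtain ⟨-, hs2⟩ := one_lt_sqrt_two_and_lt_two
  have hδ : 0 < η * Real.sqrt 2 := by positivity
  have hη2 : η * Real.sqrt 2 ≤ η * 2 := mul_le_mul_of_nonneg_left hs2.le hη.le
  have hK'R : SSContinuity.swapC '' K ⊆
      Icc (p.re - 4 * s + Real.sqrt 2 * η) (p.re - 4 * s + η * n - Real.sqrt 2 * η)
        ×ℂ Icc (p.im - s) (p.im - s + η * n / 8) := by
    rintro _ ⟨w, hw, rfl⟩
    obtain ⟨hwre, hwim⟩ := Complex.mem_reProdIm.1 (hKsub hw)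
    exact Complex.mem_reProdIm.2
      ⟨by rw [SSContinuity.swapC_re]; exact hwim, by rw [SSContinuity.swapC_im]; exact hwre⟩
  have hcross := openCrossing_of_continuum_im hδ (hKc.image SSContinuity.swapC.continuous)
    (hKconn.isPreconnected.image _ SSContinuity.swapC.continuous.continuousOn)
    (by rintro _ ⟨w, hw, rfl⟩; exact hKO w hw) hK'R
    ⟨SSContinuity.swapC u₁, mem_image_of_mem _ hu₁K, by rw [SSContinuity.swapC_im, hu₁re]⟩
    ⟨SSContinuity.swapC u₂, mem_image_of_mem _ hu₂K, by rw [SSContinuity.swapC_im, hu₂re]⟩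
  refine hno (openCrossing_mono ?_ ?_ ?_ hcross)
  · intro v hv
    obtain ⟨⟨h1, h2⟩, h3, h4⟩ := Complex.mem_reProdIm.1 hv
    rw [meshPoint_re] at h1 h2
    rw [meshPoint_im] at h3 h4
    simp only [mem_setOf_eq, squareLatticeEmbedding_z_sub_re, squareLatticeEmbedding_z_sub_im,
      mem_Icc]
    refine ⟨⟨?_, ?_⟩, ?_, ?_⟩ <;> refine le_of_mul_le_mul_left ?_ hη <;> linarith
  · intro v hv
    have hv' : η * Real.sqrt 2 * (v 1 : ℝ) ≤ p.im - s := by rw [← meshPoint_im]; exact hv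
    simp only [mem_setOf_eq, squareLatticeEmbedding_z_sub_im]
    refine le_of_mul_le_mul_left ?_ hη
    linarith
  · intro v hv
    have hv' : p.im - s + η * n / 8 ≤ η * Real.sqrt 2 * (v 1 : ℝ) := by
      rw [← meshPoint_im]; exact hv
    simp only [mem_setOf_eq, squareLatticeEmbedding_z_sub_im]
    refine le_of_mul_le_mul_left ?_ hη
    linarith

/-- **Vertical box.**  If the explicit `n/8 × n` rectangle (drawing `v ↦ √2 v - u`, left side at
`re = p.re - s`, bottom at `im = p.im - 4s`) has no open left–right lattice crossing
(`embRectCrossing`), then the plane rectangle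
`[p.re - s, p.re - s + ηn/8] × [p.im - 4s + √2η, p.im - 4s + ηn - √2η]` is not chart-crossed
(identity chart) at mesh `η√2`. -/
theorem not_chartCrossed_V {η s : ℝ} (hη : 0 < η) {n : ℕ} (p : ℂ) {u : ℂ}
    (hu₁ : η * u.re = p.re - s) (hu₂ : η * u.im = p.im - 4 * s) {ω : BondConfig (Site 2)}
    (hno : ω ∉ embRectCrossing (fun v => squareLatticeEmbedding.z v - u) ((1 / 8 : ℝ) * n) n) :
    ¬ SSContinuity.ChartCrossed (Homeomorph.refl ℂ) (p.re - s) (p.re - s + η * n / 8)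
      (p.im - 4 * s + Real.sqrt 2 * η) (p.im - 4 * s + η * n - Real.sqrt 2 * η)
      (η * Real.sqrt 2) ω := by
  rintro ⟨K, hKsub, hKc, hKconn, hKO, ⟨u₁, hu₁K, hu₁re⟩, ⟨u₂, hu₂K, hu₂re⟩⟩
  obtain ⟨-, hs2⟩ := one_lt_sqrt_two_and_lt_two
  have hδ : 0 < η * Real.sqrt 2 := by positivity
  have hη2 : η * Real.sqrt 2 ≤ η * 2 := mul_le_mul_of_nonneg_left hs2.le hη.le
  have hcross := openCrossing_of_continuum_re hδ hKc hKconn.isPreconnected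
    (fun w hw => hKO w hw) hKsub ⟨u₁, hu₁K, hu₁re.le⟩ ⟨u₂, hu₂K, hu₂re.ge⟩
  refine hno (openCrossing_mono ?_ ?_ ?_ hcross)
  · intro v hv
    obtain ⟨⟨h1, h2⟩, h3, h4⟩ := Complex.mem_reProdIm.1 hv
    rw [meshPoint_re] at h1 h2
    rw [meshPoint_im] at h3 h4
    simp only [mem_setOf_eq, squareLatticeEmbedding_z_sub_re, squareLatticeEmbedding_z_sub_im,
      mem_Icc]
    refine ⟨⟨?_, ?_⟩, ?_, ?_⟩ <;> refine le_of_mul_le_mul_left ?_ hη <;> linarith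
  · intro v hv
    have hv' : η * Real.sqrt 2 * (v 0 : ℝ) ≤ p.re - s := by rw [← meshPoint_re]; exact hv
    simp only [mem_setOf_eq, squareLatticeEmbedding_z_sub_re]
    refine le_of_mul_le_mul_left ?_ hη
    linarith
  · intro v hv
    have hv' : p.re - s + η * n / 8 ≤ η * Real.sqrt 2 * (v 0 : ℝ) := by
      rw [← meshPoint_re]; exact hv
    simp only [mem_setOf_eq, squareLatticeEmbedding_z_sub_re]
    refine le_of_mul_le_mul_left ?_ hη
    linarith

/-! ## Not chart-crossed ⇒ a long-way continuum off the drawn lattice -/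

/-- **Horizontal GOOD continuum.**  If the horizontal box of `not_chartCrossed_H` is not
chart-crossed, a continuum off the drawn lattice (open edges and vertices) lies in the band
`[p.im - s, p.im + s]`, within `[p.re - 4s, p.re + 6s]`, and reaches `re ≤ p.re - 3s` and
`re ≥ p.re + 3s` (`6η ≤ s`, `8s - η < ηn ≤ 8s`): the transposed dual path of continuum duality. -/
theorem dualH_continuum {η s : ℝ} (hη : 0 < η) (hηs : 6 * η ≤ s) {n : ℕ}
    (hn : 8 * s - η < η * n) (hn' : η * n ≤ 8 * s) (p : ℂ) {ω : BondConfig (Site 2)}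
    (h : ¬ SSContinuity.ChartCrossed SSContinuity.swapC (p.im - s) (p.im - s + η * n / 8)
      (p.re - 4 * s + Real.sqrt 2 * η) (p.re - 4 * s + η * n - Real.sqrt 2 * η)
      (η * Real.sqrt 2) ω) :
    ∃ C : Set ℂ, IsCompact C ∧ IsPreconnected C ∧
      C ⊆ {z | z ∉ openEdgeUnion (η * Real.sqrt 2) ω ∪ range (meshPoint (η * Real.sqrt 2))} ∧
      C ⊆ Icc (p.re - 4 * s) (p.re + 6 * s) ×ℂ Icc (p.im - s) (p.im + s) ∧
      (∃ z ∈ C, z.re ≤ p.re - 3 * s) ∧ ∃ z ∈ C, p.re + 3 * s ≤ z.re := by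
  obtain ⟨hs1, hs2⟩ := one_lt_sqrt_two_and_lt_two
  have hδ : 0 < η * Real.sqrt 2 := by positivity
  have hsη : 0 < Real.sqrt 2 * η := by positivity
  have hsη2 : Real.sqrt 2 * η < 2 * η := by nlinarith
  obtain ⟨β, hβc, hβR, hβ0, hβ1, hβO⟩ := SSContinuity.exists_dualPath_of_not_chartCrossed
    SSContinuity.swapC (by linarith) (by linarith) hδ h
  have h0 : (0 : ℝ) ∈ Icc (0 : ℝ) 1 := ⟨le_rfl, zero_le_one⟩
  have h1 : (1 : ℝ) ∈ Icc (0 : ℝ) 1 := ⟨zero_le_one, le_rfl⟩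
  refine ⟨SSContinuity.swapC '' (β '' Icc 0 1),
    (isCompact_Icc.image_of_continuousOn hβc).image SSContinuity.swapC.continuous,
    (isPreconnected_Icc.image β hβc).image _ SSContinuity.swapC.continuous.continuousOn, ?_, ?_,
    ⟨SSContinuity.swapC (β 1), mem_image_of_mem _ (mem_image_of_mem _ h1), ?_⟩,
    ⟨SSContinuity.swapC (β 0), mem_image_of_mem _ (mem_image_of_mem _ h0), ?_⟩⟩
  · rintro _ ⟨_, ⟨t, ht, rfl⟩, rfl⟩
    exact hβO t ht
  · rintro _ ⟨_, ⟨t, ht, rfl⟩, rfl⟩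
    obtain ⟨⟨h1', h2'⟩, h3', h4'⟩ := Complex.mem_reProdIm.1 (hβR ht)
    rw [Complex.mem_reProdIm, SSContinuity.swapC_re, SSContinuity.swapC_im]
    exact ⟨⟨by linarith, by linarith⟩, by linarith, by linarith⟩
  · rw [SSContinuity.swapC_re, hβ1]; linarith
  · rw [SSContinuity.swapC_re, hβ0]; linarith

/-- **Vertical GOOD continuum.**  If the vertical box of `not_chartCrossed_V` is not
chart-crossed, a continuum off the drawn lattice lies in the strip `[p.re - s, p.re + s]`, within
`[p.im - 4s, p.im + 6s]`, and reaches `im ≤ p.im - 3s` and `im ≥ p.im + 3s`. -/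
theorem dualV_continuum {η s : ℝ} (hη : 0 < η) (hηs : 6 * η ≤ s) {n : ℕ}
    (hn : 8 * s - η < η * n) (hn' : η * n ≤ 8 * s) (p : ℂ) {ω : BondConfig (Site 2)}
    (h : ¬ SSContinuity.ChartCrossed (Homeomorph.refl ℂ) (p.re - s) (p.re - s + η * n / 8)
      (p.im - 4 * s + Real.sqrt 2 * η) (p.im - 4 * s + η * n - Real.sqrt 2 * η)
      (η * Real.sqrt 2) ω) :
    ∃ C : Set ℂ, IsCompact C ∧ IsPreconnected C ∧
      C ⊆ {z | z ∉ openEdgeUnion (η * Real.sqrt 2) ω ∪ range (meshPoint (η * Real.sqrt 2))} ∧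
      C ⊆ Icc (p.re - s) (p.re + s) ×ℂ Icc (p.im - 4 * s) (p.im + 6 * s) ∧
      (∃ z ∈ C, z.im ≤ p.im - 3 * s) ∧ ∃ z ∈ C, p.im + 3 * s ≤ z.im := by
  obtain ⟨hs1, hs2⟩ := one_lt_sqrt_two_and_lt_two
  have hδ : 0 < η * Real.sqrt 2 := by positivity
  have hsη : 0 < Real.sqrt 2 * η := by positivity
  have hsη2 : Real.sqrt 2 * η < 2 * η := by nlinarith
  obtain ⟨β, hβc, hβR, hβ0, hβ1, hβO⟩ := SSContinuity.exists_dualPath_of_not_chartCrossed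
    (Homeomorph.refl ℂ) (by linarith) (by linarith) hδ h
  have h0 : (0 : ℝ) ∈ Icc (0 : ℝ) 1 := ⟨le_rfl, zero_le_one⟩
  have h1 : (1 : ℝ) ∈ Icc (0 : ℝ) 1 := ⟨zero_le_one, le_rfl⟩
  refine ⟨β '' Icc 0 1, isCompact_Icc.image_of_continuousOn hβc, isPreconnected_Icc.image β hβc,
    ?_, ?_, ⟨β 1, mem_image_of_mem _ h1, ?_⟩, ⟨β 0, mem_image_of_mem _ h0, ?_⟩⟩
  · rintro _ ⟨t, ht, rfl⟩
    exact hβO t ht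
  · rintro _ ⟨t, ht, rfl⟩
    obtain ⟨⟨h1', h2'⟩, h3', h4'⟩ := Complex.mem_reProdIm.1 (hβR ht)
    rw [Complex.mem_reProdIm]
    exact ⟨⟨by linarith, by linarith⟩, by linarith, by linarith⟩
  · rw [hβ1]; linarith
  · rw [hβ0]; linarith

/-- **No short-way open crossing of either box ⇒ both long-way GOOD continua** (`6η ≤ s`,
`8s - η < ηn ≤ 8s`): the two `chain` inputs at the tube point `p`, with `GOOD` the complement of
the drawn lattice (open edges and vertices at mesh `η√2`). -/
theorem continua_of_not_mem {η s : ℝ} (hη : 0 < η) (hηs : 6 * η ≤ s) {n : ℕ}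
    (hn : 8 * s - η < η * n) (hn' : η * n ≤ 8 * s) (p : ℂ) {ω : BondConfig (Site 2)}
    (hH : ω ∉ embTBCrossing (fun v => squareLatticeEmbedding.z v -
      ⟨(p.re - 4 * s) / η, (p.im - s) / η⟩) n ((1 / 8 : ℝ) * n))
    (hV : ω ∉ embRectCrossing (fun v => squareLatticeEmbedding.z v -
      ⟨(p.re - s) / η, (p.im - 4 * s) / η⟩) ((1 / 8 : ℝ) * n) n) :
    (∃ C : Set ℂ, IsCompact C ∧ IsPreconnected C ∧
      C ⊆ {z | z ∉ openEdgeUnion (η * Real.sqrt 2) ω ∪ range (meshPoint (η * Real.sqrt 2))} ∧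
      C ⊆ Icc (p.re - 4 * s) (p.re + 6 * s) ×ℂ Icc (p.im - s) (p.im + s) ∧
      (∃ z ∈ C, z.re ≤ p.re - 3 * s) ∧ ∃ z ∈ C, p.re + 3 * s ≤ z.re) ∧
    ∃ C : Set ℂ, IsCompact C ∧ IsPreconnected C ∧
      C ⊆ {z | z ∉ openEdgeUnion (η * Real.sqrt 2) ω ∪ range (meshPoint (η * Real.sqrt 2))} ∧
      C ⊆ Icc (p.re - s) (p.re + s) ×ℂ Icc (p.im - 4 * s) (p.im + 6 * s) ∧
      (∃ z ∈ C, z.im ≤ p.im - 3 * s) ∧ ∃ z ∈ C, p.im + 3 * s ≤ z.im :=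
  have hη' : η ≠ 0 := hη.ne'
  ⟨dualH_continuum hη hηs hn hn' p
      (not_chartCrossed_H hη p (by simp only; field_simp) (by simp only; field_simp) hH),
    dualV_continuum hη hηs hn hn' p
      (not_chartCrossed_V hη p (by simp only; field_simp) (by simp only; field_simp) hV)⟩

end Summit.CriticalPhenomena.CardyFormulaZ2.Theorems.CardySelfRefinement

end
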